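import Mathlib
import HarnessLib

/-!
# Smoothness of alternating-form-valued maps from smoothness of evaluations —
crux HeckeEigenvalueField (stmt-Langlands-13632), line Sketch, stub DICT-W1

Statement: let `W`, `V` be finite-dimensional real normed spaces and
`f : M → W [⋀^Fin q]→L[ℝ] V` a map into continuous alternating `q`-forms.  If every
evaluation `m ↦ f m v` (`v : Fin q → W`) is `C^k` on `s`, then `f` itself is `C^k` on `s`
(for every `k : WithTop ℕ∞`, including `ω`).

Proof idea: fix a finite basis `b` of `W`.  Evaluation on basis tuples
`L : (W [⋀^Fin q]→L[ℝ] V) →ₗ[ℝ] ((Fin q → Fin d) → V)` is linear and injective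
(`Module.Basis.ext_alternating`), so the space of forms is finite-dimensional and `L` has a
linear, automatically continuous, left inverse `P`.  Then `f = P ∘ (L ∘ f)`, where `L ∘ f`
is `C^k` coordinatewise by hypothesis (`contDiffOn_pi`) and `P` is a continuous linear map.
This is the Borel–Wallach dictionary's calculus input: a form-valued map on the symmetric
space is smooth once its evaluations are.  References: standard finite-dimensional calculus
(Mathlib `contDiffOn_clm_apply` is the analogous statement for continuous linear maps).
-/

set_option linter.dupNamespace false -- project-wide: `Summit.Langlands.Langlands` is the mandated namespace

noncomputable section

namespace Summit.Langlands.Langlands.Theorems.HeckeEigenvalueField.Res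

/-- **Dictionary calculus W1.**  A map `f : M → W [⋀^Fin q]→L[ℝ] V` into continuous
alternating forms on a finite-dimensional space `W` with values in a finite-dimensional
space `V` is `C^k` on `s` as soon as all its evaluations `m ↦ f m v` are.  Proof: evaluate
on tuples of basis vectors (an injective linear map into a finite product of copies of `V`),
use `contDiffOn_pi`, and compose with a continuous linear left inverse. [folklore] -/
theorem stub_contDiffOn_continuousAlternatingMap_of_apply
    {M W V : Type} [NormedAddCommGroup M] [NormedSpace ℝ M]
    [NormedAddCommGroup W] [NormedSpace ℝ W] [FiniteDimensional ℝ W]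
    [NormedAddCommGroup V] [NormedSpace ℝ V] [FiniteDimensional ℝ V]
    {q : ℕ} {k : WithTop ℕ∞} {s : Set M} (f : M → W [⋀^Fin q]→L[ℝ] V)
    (h : ∀ v : Fin q → W, ContDiffOn ℝ k (fun m => f m v) s) : ContDiffOn ℝ k f s := by
  -- a finite basis of `W`
  let b := Module.finBasis ℝ W
  -- evaluation on tuples of basis vectors, as a linear map into a finite product
  let L : (W [⋀^Fin q]→L[ℝ] V) →ₗ[ℝ] ((Fin q → Fin (Module.finrank ℝ W)) → V) :=
    { toFun := fun g idx => g (fun i => b (idx i))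
      map_add' := fun _ _ => rfl
      map_smul' := fun _ _ => rfl }
  -- `L` is injective: a continuous alternating map is determined by its values on basis tuples
  have hL : Function.Injective L := by
    intro g₁ g₂ hg
    apply ContinuousAlternatingMap.toAlternatingMap_injective
    refine Module.Basis.ext_alternating b fun v _ => ?_
    exact congr_fun hg v
  have hker : LinearMap.ker L = ⊥ := LinearMap.ker_eq_bot.mpr hL
  -- hence the space of forms is finite-dimensional and `L` has a continuous linear left inverse
  haveI : FiniteDimensional ℝ (W [⋀^Fin q]→L[ℝ] V) := FiniteDimensional.of_injective L hL
  let P : ((Fin q → Fin (Module.finrank ℝ W)) → V) →L[ℝ] (W [⋀^Fin q]→L[ℝ] V) :=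
    LinearMap.toContinuousLinearMap L.leftInverse
  have hPL : ∀ g, P (L g) = g := fun g => LinearMap.leftInverse_apply_of_inj hker g
  -- `L ∘ f` is `C^k` coordinatewise, by hypothesis
  have h1 : ContDiffOn ℝ k (fun m => L (f m)) s :=
    contDiffOn_pi.mpr fun idx => h fun i => b (idx i)
  -- `f = P ∘ L ∘ f`
  have hf : f = fun m => P (L (f m)) := funext fun m => (hPL (f m)).symm
  rw [hf]
  exact P.contDiff.comp_contDiffOn h1

end Summit.Langlands.Langlands.Theorems.HeckeEigenvalueField.Res

end
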